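import Mathlib
import HarnessLib
import Literature.Analysis.FluidPDE.NSWave0

/-!
# The R2 force budget delivers a Clay-class force — what "smooth THROUGH the blow-up time" costs

Cell `ns-blowup`, seat `ns-blowup-ecbridge-1`; LABEL: E-C typing (Clay (C) force class (5)–(6));
WHAT THIS IS NOT: not Navier–Stokes, not a construction — a lemma about series of smooth functions.
Companion of `PalasekTowerClayBridge.lean`, whose interface `Realisation` asks for a force
`f ∈ C^∞([0, ∞) × ℝ³)` (`IsSmoothOnHalfSpace`) with Fefferman's space-time decay (5)
(`HasRapidSpaceTimeDecay`) and silence from the blow-up time `T` on. The cell's FORCE-BUDGET RULE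
R2 (TARGET §2) builds `f` level by level: `f = Σ_k g_k`, each `g_k` a smooth space-time field
supported in the tower's ball and switched off before `T` (Palasek arXiv:2605.13827 §3.3:
`g_k = (1 - ρ_k(t)) N_k² x_k`, supported in `t ≤ t_k/2 < T`), every `C^m` norm of `g_k` being
super-exponentially small in `k` (`≲ N_k^{2+m} A_k exp(-(c/4) A_{k-1}/A_{k-2})`, summable). The
theorem is the exact typing statement: SUMMABLE `C^m` BOUNDS for every `m` plus the two support
conditions give all three force clauses of the interface — smoothness ACROSS the blow-up time is
automatic from the budget (the cell's T23 / "Sohr corner" demand «state f's time-regularity class at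
T*» is answered at the level of types: `C^∞`, identically zero on `[T, ∞)`), whereas a
polynomially-sized active-phase residual violates the summability hypothesis and is the fluid's
problem, never the force's (R2 clause 2; T22).

References: S. Palasek, arXiv:2605.13827 §3.3 [cite: Palasek2026ElementaryModel, §3.3 and Rem. 1.4];
C. L. Fefferman, Clay problem description, (5) (6) [cite: FeffermanClay2006, (5) (6)].
-/

noncomputable section

namespace Summit.NavierStokesRegularity.FluidComputer.PalasekTowerForceBudget

open Set Filter Topology Function
open scoped ContDiff
open Literature.Analysis.FluidPDE


section ForceAssembly

variable (g : ℕ → ℝ × EuclideanSpace ℝ (Fin 3) → EuclideanSpace ℝ (Fin 3)) (T Rb : ℝ)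

/-- **R2 ⇒ Clay (5), (6) and silence.** Let `g_k : ℝ × ℝ³ → ℝ³` be smooth space-time fields,
each vanishing for `t ≥ T` and for `|x| ≥ R_b`, with summable uniform bounds on every space-time
derivative: `‖D^m g_k‖_∞ ≤ v_m(k)`, `Σ_k v_m(k) < ∞` for each `m`. Then `f(t, x) := Σ_k g_k(t, x)`
is smooth on the closed half-space `[0, ∞) × ℝ³` (indeed on all of `ℝ × ℝ³`, Mathlib
`contDiff_tsum`), has Fefferman's space-time decay (5) (it is supported in the compact box
`[0, T] × B̄(0, R_b)` of the half-space, where every derivative is bounded), and vanishes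
identically for `t ≥ T`. [folklore] -/
theorem clayForce_of_summable_levels
    (hg : ∀ k, ContDiff ℝ ∞ (g k))
    (hT : ∀ k z, T ≤ z.1 → g k z = 0)
    (hR : ∀ k z, Rb ≤ ‖z.2‖ → g k z = 0)
    (hsum : ∀ m : ℕ, ∃ v : ℕ → ℝ, Summable v ∧ ∀ k z, ‖iteratedFDeriv ℝ m (g k) z‖ ≤ v k) :
    IsSmoothOnHalfSpace (fun t x => ∑' k, g k (t, x)) ∧
      HasRapidSpaceTimeDecay (fun t x => ∑' k, g k (t, x)) ∧
      ∀ t, T ≤ t → ∀ x, (∑' k, g k (t, x)) = 0 := by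
  -- the uncurried sum
  set F : ℝ × EuclideanSpace ℝ (Fin 3) → EuclideanSpace ℝ (Fin 3) := fun z => ∑' k, g k z
    with hFdef
  have hunc : uncurry (fun t x => ∑' k, g k (t, x)) = F := by
    funext z
    rfl
  -- smoothness of the sum from the summable `C^m` bounds
  choose v hv hgv using hsum
  have hF : ContDiff ℝ ∞ F := by
    refine contDiff_tsum (N := (⊤ : ℕ∞)) hg (v := v) (fun m _ => hv m) ?_
    intro m k z _
    exact hgv m k z
  -- silence for `t ≥ T`
  have hsilent : ∀ t, T ≤ t → ∀ x, F (t, x) = 0 := by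
    intro t ht x
    simp only [hFdef]
    have : ∀ k, g k (t, x) = 0 := fun k => hT k (t, x) ht
    simp [this]
  -- support of `F` inside the closed box `(-∞, T] × B̄(0, R_b)`
  have hsupp : tsupport F ⊆ Iic T ×ˢ Metric.closedBall (0 : EuclideanSpace ℝ (Fin 3)) Rb := by
    refine closure_minimal ?_ (isClosed_Iic.prod Metric.isClosed_closedBall)
    intro z hz
    rw [Function.mem_support] at hz
    refine mk_mem_prod ?_ ?_
    · by_contra h
      have h' : T ≤ z.1 := le_of_lt (not_le.mp h)
      apply hz
      simp only [hFdef]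
      have : ∀ k, g k z = 0 := fun k => hT k z h'
      simp [this]
    · rw [Metric.mem_closedBall, dist_zero_right]
      by_contra h
      have h' : Rb ≤ ‖z.2‖ := le_of_lt (not_le.mp h)
      apply hz
      simp only [hFdef]
      have : ∀ k, g k z = 0 := fun k => hR k z h'
      simp [this]
  refine ⟨?_, ?_, ?_⟩
  · -- (6): smooth on the closed half-space
    show ContDiffOn ℝ ∞ (uncurry fun t x => ∑' k, g k (t, x)) (Ici (0 : ℝ) ×ˢ univ)
    rw [hunc]
    exact hF.contDiffOn
  · -- (5): space-time decay, from compact support inside the half-space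
    intro n K
    -- the within-derivative on the half-space is the free derivative
    have hUD : UniqueDiffOn ℝ (Ici (0 : ℝ) ×ˢ (univ : Set (EuclideanSpace ℝ (Fin 3)))) :=
      (uniqueDiffOn_Ici 0).prod uniqueDiffOn_univ
    have hwithin : ∀ z ∈ Ici (0 : ℝ) ×ˢ (univ : Set (EuclideanSpace ℝ (Fin 3))),
        iteratedFDerivWithin ℝ n F (Ici (0 : ℝ) ×ˢ univ) z = iteratedFDeriv ℝ n F z :=
      fun z hz =>
        iteratedFDerivWithin_eq_iteratedFDeriv hUD (hF.contDiffAt.of_le (by exact_mod_cast le_top)) hz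
    -- the weighted derivative is continuous, hence bounded on the compact box
    set Φ : ℝ × EuclideanSpace ℝ (Fin 3) → ℝ :=
      fun z => (1 + ‖z.2‖ + z.1) ^ K * ‖iteratedFDeriv ℝ n F z‖ with hΦdef
    have hΦc : Continuous Φ := by
      have h1 : Continuous fun z : ℝ × EuclideanSpace ℝ (Fin 3) => (1 + ‖z.2‖ + z.1) ^ K :=
        ((continuous_const.add continuous_snd.norm).add continuous_fst).pow K
      exact h1.mul (hF.continuous_iteratedFDeriv (m := n) (by exact_mod_cast le_top)).norm
    have hbox : IsCompact (Icc (0 : ℝ) T ×ˢ Metric.closedBall (0 : EuclideanSpace ℝ (Fin 3)) Rb) :=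
      isCompact_Icc.prod (isCompact_closedBall _ _)
    obtain ⟨C, hC⟩ := hbox.exists_bound_of_continuousOn hΦc.continuousOn
    refine ⟨max C 0, fun t ht x => ?_⟩
    have hz : ((t, x) : ℝ × EuclideanSpace ℝ (Fin 3)) ∈ Ici (0 : ℝ) ×ˢ (univ : Set _) :=
      mk_mem_prod ht (mem_univ _)
    rw [hunc, hwithin _ hz]
    by_cases hmem : ((t, x) : ℝ × EuclideanSpace ℝ (Fin 3)) ∈
        Icc (0 : ℝ) T ×ˢ Metric.closedBall (0 : EuclideanSpace ℝ (Fin 3)) Rb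
    · have := hC _ hmem
      simp only [hΦdef, Real.norm_eq_abs] at this
      exact le_trans (le_trans (le_abs_self _) this) (le_max_left _ _)
    · -- outside the box the derivative vanishes
      have hnot : ((t, x) : ℝ × EuclideanSpace ℝ (Fin 3)) ∉ tsupport F := by
        intro hts
        apply hmem
        have hb := hsupp hts
        exact mk_mem_prod ⟨ht, hb.1⟩ hb.2
      have hzero : iteratedFDeriv ℝ n F (t, x) = 0 :=
        Function.notMem_support.mp (fun h => hnot (support_iteratedFDeriv_subset n h))
      rw [hzero, norm_zero, mul_zero]
      exact le_max_right _ _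
  · exact hsilent

end ForceAssembly

end Summit.NavierStokesRegularity.FluidComputer.PalasekTowerForceBudget

end
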